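import Summits.MatrixMultiplication.MatrixMultiplication.Theorems.AsymptoticRankCWSkewQuantumTie
import Literature.Computability.AlgebraicComplexity.DegenerationSpectralMonotone

/-!
# The degeneration doors to `BSkewDominatesCw` (stmt-MatrixMultiplication-18009): catalytic and
format-changing degenerations of Kronecker powers give pointwise spectral domination

Route `MatrixMultiplication/AsymptoticRankCW`, crux `BThesis` (stmt-MatrixMultiplication-0588), line
`Cruxes/BThesis/Lines/skew_anchor.lean`, stub `stub_skewDominatesCw` = item `BSkewDominatesCw` (stmt-18009):
`R̃(T_cw,2) ≤ R̃(ε)`. By `bSkewDominatesCw_of_forall_spectralPoint_le_spectralPoint`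
(`AsymptoticRankCWSkewQuantumTie.lean`) the pointwise domination `∀ F ∈ Δ(ℂ), F(T_cw,2) ≤ F(ε)` suffices.
This file records, as theorems, the three degeneration mechanisms that would produce it — each a
statement about explicit finite tensors, i.e. a target for computation — using that universal spectral
points are monotone under (algebraic, `ℂ[λ]`-) degeneration (Strassen 1988 §3, PROVED in tree:
`IsUniversalSpectralPoint.mono_of_algDegeneratesTo`), multiplicative under `⊠`, additive under `⊕`,
and `≥ 1` on nonzero tensors:

* **Kronecker catalyst**: `ε^{⊠k} ⊠ τ ⊵ T_cw,2^{⊠k} ⊠ τ` for ONE `k ≥ 1` and ONE nonzero `τ` (any format)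
  gives `F(T_cw,2) ≤ F(ε)` for all `F ∈ Δ(ℂ)` (`F(τ) ≥ 1` cancels, then `k`-th roots), hence 18009.
* **Direct-sum catalyst**: `ε^{⊠k} ⊕ τ ⊵ T_cw,2^{⊠k} ⊕ τ` likewise (additivity).
* **Format-changing powers**: degenerations `ε^{⊠(k+j)} ⊵ T_cw,2^{⊠k}` with `j/k` arbitrarily small give
  `F(T_cw,2) ≤ F(ε)^{1+δ}` for every `δ > 0`, hence `F(T_cw,2) ≤ F(ε)` (this is `T_cw,2 ≲ ε` unfolded).

Which doors are already shut (evidence `equal-format-nogo.md` on the item, exact stabilizer computations +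
orbit dimension): the catalyst doors with `τ = ⟨r⟩` (diagonal), with `τ` any direct-sum catalyst, and
with `τ` any Kronecker monomial in `T_cw,2` and `ε`, for EVERY `k` (the `T_cw,2`-side orbit is larger by
`6k`); `j = 0` of the third door for every `k` (k = 1: tree `not_polyDegeneratesTo_leviCivita_cwTensor_two`).
What remains: Kronecker catalysts with accidental joint symmetry, and genuinely format-changing families.

All sorry-free; standard axioms; no definitions.

References. V. Strassen, J. reine angew. Math. 384 (1988), §3; M. Christandl, P. Vrana, J. Zuiddam,
J. Amer. Math. Soc. 36 (2023) = arXiv:1709.07851, §1.2 and Prop. 1.6; P. Bürgisser, M. Clausen,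
M. A. Shokrollahi, *Algebraic Complexity Theory* (1997), (15.19)–(15.26).
-/

set_option linter.dupNamespace false

noncomputable section

namespace Summit.MatrixMultiplication.MatrixMultiplication.Theorems

open scoped BigOperators Topology
open Filter
open Literature.Computability.AlgebraicComplexity
open Summit.MatrixMultiplication.MatrixMultiplication.Theses.AsymptoticRankCW

/-! ## A universal spectral point is `≥ 1` on nonzero tensors -/

/-- `1 ≤ F(τ)` for a universal spectral point `F` and `τ ≠ 0` (`τ ≥ ⟨1⟩`, CVZ §1.2).
[cite: ChristandlVranaZuiddam2023, §1.2] -/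
theorem one_le_spectralPoint_of_ne_zero {F : SpectralMap ℂ} (hF : IsUniversalSpectralPoint ℂ F)
    {ι κ μ : Type} [Fintype ι] [Fintype κ] [Fintype μ] {τ : ι → κ → μ → ℂ} (hτ : τ ≠ 0) :
    1 ≤ F τ := by
  rw [← hF.map_unitTensor_one]
  exact hF.mono _ _ (TensorClass.restrictsTo_unitTensor_one_of_ne_zero hτ)

/-! ## Door 1: a Kronecker catalyst -/

/-- **Kronecker-catalytic degeneration ⇒ pointwise spectral domination.** If for some `k ≥ 1` and some
nonzero tensor `τ` the tensor `ε^{⊠k} ⊠ τ` degenerates (over `ℂ[λ]`) to `T_cw,2^{⊠k} ⊠ τ`, then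
`F(T_cw,2) ≤ F(ε)` for every universal spectral point `F`: `F(T_cw,2)^k F(τ) ≤ F(ε)^k F(τ)` with
`F(τ) ≥ 1 > 0`. [cite: Strassen1988, §3] -/
theorem spectralPoint_le_of_kroneckerCatalyst {ι κ μ : Type} [Fintype ι] [Fintype κ] [Fintype μ]
    {τ : ι → κ → μ → ℂ} (hτ : τ ≠ 0) {k : ℕ} (hk : 0 < k)
    (h : AlgDegeneratesTo
      (kroneckerTensor (kroneckerPow (fun a b c : Fin 3 =>
        (if b = a + 1 ∧ c = a + 2 then (1 : ℂ) else 0) - (if b = a + 2 ∧ c = a + 1 then 1 else 0)) k) τ)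
      (kroneckerTensor (kroneckerPow (cwTensor ℂ 2) k) τ))
    {F : SpectralMap ℂ} (hF : IsUniversalSpectralPoint ℂ F) :
    F (cwTensor ℂ 2) ≤ F (fun a b c : Fin 3 =>
      (if b = a + 1 ∧ c = a + 2 then (1 : ℂ) else 0) - (if b = a + 2 ∧ c = a + 1 then 1 else 0)) := by
  have hmono := hF.mono_of_algDegeneratesTo h
  rw [hF.map_kronecker, hF.map_kronecker, hF.map_kroneckerPow, hF.map_kroneckerPow] at hmono
  have hτpos : 0 < F τ := one_pos.trans_le (one_le_spectralPoint_of_ne_zero hF hτ)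
  have hpow := le_of_mul_le_mul_right hmono hτpos
  exact (pow_le_pow_iff_left₀ (hF.nonneg _) (hF.nonneg _) hk.ne').1 hpow

/-- **Door 1 ⇒ `BSkewDominatesCw`.** [cite: Strassen1988, §3] -/
theorem bSkewDominatesCw_of_kroneckerCatalyst {ι κ μ : Type} [Fintype ι] [Fintype κ] [Fintype μ]
    {τ : ι → κ → μ → ℂ} (hτ : τ ≠ 0) {k : ℕ} (hk : 0 < k)
    (h : AlgDegeneratesTo
      (kroneckerTensor (kroneckerPow (fun a b c : Fin 3 =>
        (if b = a + 1 ∧ c = a + 2 then (1 : ℂ) else 0) - (if b = a + 2 ∧ c = a + 1 then 1 else 0)) k) τ)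
      (kroneckerTensor (kroneckerPow (cwTensor ℂ 2) k) τ)) :
    BSkewDominatesCw :=
  bSkewDominatesCw_of_forall_spectralPoint_le_spectralPoint
    fun _ hF => spectralPoint_le_of_kroneckerCatalyst hτ hk h hF

/-! ## Door 2: a direct-sum catalyst -/

/-- **Direct-sum-catalytic degeneration ⇒ pointwise spectral domination**: if
`ε^{⊠k} ⊕ τ ⊵ T_cw,2^{⊠k} ⊕ τ` for some `k ≥ 1` and some `τ`, then `F(T_cw,2) ≤ F(ε)` for every
`F ∈ Δ(ℂ)` (additivity cancels `F(τ)`). (Shut for every `k` and every `τ` by orbit dimension — see the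
item's evidence `equal-format-nogo.md`; recorded for completeness of the dictionary.) [cite: Strassen1988, §3] -/
theorem spectralPoint_le_of_directSumCatalyst {ι κ μ : Type} [Fintype ι] [Fintype κ] [Fintype μ]
    (τ : ι → κ → μ → ℂ) {k : ℕ} (hk : 0 < k)
    (h : AlgDegeneratesTo
      (directSumTensor (kroneckerPow (fun a b c : Fin 3 =>
        (if b = a + 1 ∧ c = a + 2 then (1 : ℂ) else 0) - (if b = a + 2 ∧ c = a + 1 then 1 else 0)) k) τ)
      (directSumTensor (kroneckerPow (cwTensor ℂ 2) k) τ))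
    {F : SpectralMap ℂ} (hF : IsUniversalSpectralPoint ℂ F) :
    F (cwTensor ℂ 2) ≤ F (fun a b c : Fin 3 =>
      (if b = a + 1 ∧ c = a + 2 then (1 : ℂ) else 0) - (if b = a + 2 ∧ c = a + 1 then 1 else 0)) := by
  have hmono := hF.mono_of_algDegeneratesTo h
  rw [hF.map_directSum, hF.map_directSum, hF.map_kroneckerPow, hF.map_kroneckerPow] at hmono
  have hpow := le_of_add_le_add_right hmono
  exact (pow_le_pow_iff_left₀ (hF.nonneg _) (hF.nonneg _) hk.ne').1 hpow

/-- **Door 2 ⇒ `BSkewDominatesCw`.** [cite: Strassen1988, §3] -/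
theorem bSkewDominatesCw_of_directSumCatalyst {ι κ μ : Type} [Fintype ι] [Fintype κ] [Fintype μ]
    (τ : ι → κ → μ → ℂ) {k : ℕ} (hk : 0 < k)
    (h : AlgDegeneratesTo
      (directSumTensor (kroneckerPow (fun a b c : Fin 3 =>
        (if b = a + 1 ∧ c = a + 2 then (1 : ℂ) else 0) - (if b = a + 2 ∧ c = a + 1 then 1 else 0)) k) τ)
      (directSumTensor (kroneckerPow (cwTensor ℂ 2) k) τ)) :
    BSkewDominatesCw :=
  bSkewDominatesCw_of_forall_spectralPoint_le_spectralPoint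
    fun _ hF => spectralPoint_le_of_directSumCatalyst τ hk h hF

/-! ## Door 3: format-changing Kronecker powers with vanishing overhead -/

/-- Real-analysis step: if `a ≤ b^{1+δ}` for every `δ > 0`, with `0 < b`, then `a ≤ b`
(`δ ↦ b^{1+δ}` is continuous at `0`). [folklore] -/
theorem le_of_forall_pos_le_rpow_one_add {a b : ℝ} (hb : 0 < b)
    (h : ∀ δ : ℝ, 0 < δ → a ≤ b ^ (1 + δ)) : a ≤ b := by
  have hcont : Tendsto (fun δ : ℝ => b ^ (1 + δ)) (𝓝[>] (0 : ℝ)) (𝓝 b) := by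
    have h1 : Tendsto (fun δ : ℝ => b ^ (1 + δ)) (𝓝 (0 : ℝ)) (𝓝 (b ^ (1 + (0 : ℝ)))) :=
      ((Real.continuousAt_const_rpow hb.ne').tendsto).comp
        ((continuous_const.add continuous_id).tendsto 0)
    rw [add_zero, Real.rpow_one] at h1
    exact h1.mono_left nhdsWithin_le_nhds
  refine ge_of_tendsto hcont ?_
  filter_upwards [self_mem_nhdsWithin] with δ hδ
  exact h δ hδ

/-- **Format-changing degenerations with `j/k → 0` ⇒ pointwise spectral domination**: if for every
`δ > 0` there are `k ≥ 1`, `j` with `j ≤ δ k` and a degeneration `ε^{⊠(k+j)} ⊵ T_cw,2^{⊠k}`, then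
`F(T_cw,2) ≤ F(ε)` for every `F ∈ Δ(ℂ)`: `F(T_cw,2)^k ≤ F(ε)^{k+j} ≤ (F(ε)^{1+δ})^k` since
`F(ε) ≥ 1`. (The `j = 0` instances are impossible for every `k`; `j ≥ 1` fixed gives only
`F(T_cw,2) ≤ F(ε)^{1+j/k}`.) [cite: Strassen1988, §3] -/
theorem spectralPoint_le_of_asymptoticDegenerations
    (h : ∀ δ : ℝ, 0 < δ → ∃ k j : ℕ, 0 < k ∧ (j : ℝ) ≤ δ * k ∧
      AlgDegeneratesTo
        (kroneckerPow (fun a b c : Fin 3 =>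
          (if b = a + 1 ∧ c = a + 2 then (1 : ℂ) else 0) - (if b = a + 2 ∧ c = a + 1 then 1 else 0)) (k + j))
        (kroneckerPow (cwTensor ℂ 2) k))
    {F : SpectralMap ℂ} (hF : IsUniversalSpectralPoint ℂ F) :
    F (cwTensor ℂ 2) ≤ F (fun a b c : Fin 3 =>
      (if b = a + 1 ∧ c = a + 2 then (1 : ℂ) else 0) - (if b = a + 2 ∧ c = a + 1 then 1 else 0)) := by
  set e : ℝ := F (fun a b c : Fin 3 =>
      (if b = a + 1 ∧ c = a + 2 then (1 : ℂ) else 0) - (if b = a + 2 ∧ c = a + 1 then 1 else 0)) with he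
  have he1 : 1 ≤ e := one_le_spectralPoint_of_ne_zero hF leviCivitaInline_ne_zero
  have he0 : 0 < e := one_pos.trans_le he1
  refine le_of_forall_pos_le_rpow_one_add he0 fun δ hδ => ?_
  obtain ⟨k, j, hk, hjk, hdeg⟩ := h δ hδ
  have hmono := hF.mono_of_algDegeneratesTo hdeg
  rw [hF.map_kroneckerPow, hF.map_kroneckerPow] at hmono
  -- `e^{k+j} ≤ (e^{1+δ})^k`
  have hexp : e ^ (k + j) ≤ (e ^ (1 + δ)) ^ k := by
    rw [← Real.rpow_natCast e (k + j), ← Real.rpow_mul_natCast he0.le]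
    refine Real.rpow_le_rpow_of_exponent_le he1 ?_
    push_cast
    nlinarith
  have hpow : F (cwTensor ℂ 2) ^ k ≤ (e ^ (1 + δ)) ^ k := hmono.trans hexp
  exact (pow_le_pow_iff_left₀ (hF.nonneg _) (Real.rpow_nonneg he0.le _) hk.ne').1 hpow

/-- **Door 3 ⇒ `BSkewDominatesCw`** (asymptotic degeneration `T_cw,2 ≲ ε`, unfolded, implies the item).
[cite: Strassen1988, §3] -/
theorem bSkewDominatesCw_of_asymptoticDegenerations
    (h : ∀ δ : ℝ, 0 < δ → ∃ k j : ℕ, 0 < k ∧ (j : ℝ) ≤ δ * k ∧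
      AlgDegeneratesTo
        (kroneckerPow (fun a b c : Fin 3 =>
          (if b = a + 1 ∧ c = a + 2 then (1 : ℂ) else 0) - (if b = a + 2 ∧ c = a + 1 then 1 else 0)) (k + j))
        (kroneckerPow (cwTensor ℂ 2) k)) :
    BSkewDominatesCw :=
  bSkewDominatesCw_of_forall_spectralPoint_le_spectralPoint
    fun _ hF => spectralPoint_le_of_asymptoticDegenerations h hF

end Summit.MatrixMultiplication.MatrixMultiplication.Theorems

end
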